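import Literature.Analysis.Calculus.EnergyTailCutoff
import HarnessLib

/-!
# Crux `ClusterCompleteness.OmegaLimitMultiKerr` (stmt-FinalStateConjecture-14664), line `Sketch` —
# Barbalat's lemma and the window tails of an integrable budget

Support lemmas (structure stub `barbalat_tendsto_zero`, lead gen 3) for the "dark-limit dictionary"
of the LaSalle route to the crux `OmegaLimitMultiKerr`: along a development the Bondi mass is
monotone and bounded below, so the radiated flux `F ≥ 0` is integrable on a half-line `[a, ∞)`; the
dictionary turns this integrated budget into the vanishing of the flux through every LATE WINDOW
`[t - L, t + L]` (so that no ω-limit along a sequence of times `T n → +∞` radiates through the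
window), and, under tameness (uniformly continuous or Lipschitz flux), into POINTWISE decay. Nothing
here is specific to general relativity: pure real analysis over Mathlib.

* `tendsto_setIntegral_Ici_of_integrableOn` — tails `∫_{[t, ∞)} g → 0` of an integrable `g`
  (the tree's `Literature.Analysis.Calculus.tendsto_setIntegral_Ioi_tail` on closed half-lines).
* `tendsto_setIntegral_Icc_add_of_integrableOn` — WINDOW TAILS: if `f` (values in a normed space)
  is integrable on `Ici a` then `∫_{[t, t + L]} f → 0` as `t → +∞`, for every `L`; norm form
  `tendsto_setIntegral_Icc_add_norm_of_integrableOn`; centred windows `[t - L, t + L]`,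
  `tendsto_setIntegral_Icc_sub_add_of_integrableOn`; and the discrete reading along times
  `T n → +∞`, `tendsto_setIntegral_Icc_sub_add_comp_of_tendsto`. Measure form (for budgets given as
  a finite measure on the time axis, e.g. a news flux): `tendsto_measure_Icc_sub_add_of_ne_top`.
* `tendsto_zero_of_uniformContinuousOn_of_integrableOn` — BARBALAT'S LEMMA in a normed group: a
  function uniformly continuous and integrable on `Ici a` tends to `0` at `+∞`;
  `barbalat_tendsto_zero` — the registered real-valued closed form (no sign condition is needed:
  the textbook statement for a nonnegative integrable dissipation rate is the special case `0 ≤ f`);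
  `tendsto_zero_of_lipschitzOnWith_of_integrableOn` — the Lipschitz (tame) variant.

Proof of Barbalat's lemma (Barbalat, *Systèmes d'équations différentielles d'oscillations non
linéaires*, Rev. Math. Pures Appl. 4 (1959) 267–270; textbook form: Khalil, *Nonlinear Systems*,
3rd ed., Lemma 8.2): if `‖f t‖ ≥ ε` at arbitrarily late times `t`, uniform continuity gives `δ > 0`
with `‖f‖ ≥ ε / 2` on `[t, t + δ]`, whence `∫_{[t, t + δ]} ‖f‖ ≥ ε δ / 2` at arbitrarily late `t`,
contradicting the window tails of the integrable function `‖f‖`.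

Everything is proved; Mathlib + `Literature.Analysis.Calculus.EnergyTailCutoff` only, no definitions.
-/

-- every `Summit.FinalStateConjecture.FinalStateConjecture.…` name repeats the summit = sub-problem segment (D-0017 layout)
set_option linter.dupNamespace false

noncomputable section

open scoped Manifold ContDiff Topology ENNReal NNReal
open Set Filter TopologicalSpace

namespace Summit.FinalStateConjecture.FinalStateConjecture.Theorems.ClusterCompleteness

open MeasureTheory

variable {E : Type*} [NormedAddCommGroup E]

/-! ### Window tails of an integrable budget -/

/-- **Tails over closed half-lines.** If `g : ℝ → ℝ` is integrable on `Ici a` then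
`∫_{[t, ∞)} g → 0` as `t → +∞` (the tree's `tendsto_setIntegral_Ioi_tail`; the half-lines `Ioi t`
and `Ici t` differ by a Lebesgue-null set). [folklore] -/
theorem tendsto_setIntegral_Ici_of_integrableOn {g : ℝ → ℝ} {a : ℝ} (hg : IntegrableOn g (Ici a)) :
    Tendsto (fun t ↦ ∫ s in Ici t, g s) atTop (𝓝 0) :=
  (Literature.Analysis.Calculus.tendsto_setIntegral_Ioi_tail
    (hg.mono_set Ioi_subset_Ici_self)).congr fun _ ↦ setIntegral_congr_set Ioi_ae_eq_Ici

/-- **Window tails of an integrable budget.** If `f` is integrable on the half-line `Ici a`, then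
its integral over the late window `[t, t + L]` tends to `0` as `t → +∞`, for every `L`
(`‖∫_{[t, t + L]} f‖ ≤ ∫_{[t, ∞)} ‖f‖ → 0`). Integrability only: no sign, continuity or
completeness assumption. [folklore] -/
theorem tendsto_setIntegral_Icc_add_of_integrableOn [NormedSpace ℝ E] {f : ℝ → E} {a : ℝ}
    (hf : IntegrableOn f (Ici a)) (L : ℝ) :
    Tendsto (fun t ↦ ∫ s in Icc t (t + L), f s) atTop (𝓝 0) := by
  have hfn : IntegrableOn (fun s ↦ ‖f s‖) (Ici a) := hf.norm
  refine squeeze_zero_norm' ?_ (tendsto_setIntegral_Ici_of_integrableOn hfn)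
  filter_upwards [eventually_ge_atTop a] with t ht
  exact (norm_integral_le_integral_norm _).trans
    (setIntegral_mono_set (hfn.mono_set (Ici_subset_Ici.2 ht))
      (ae_of_all _ fun _ ↦ norm_nonneg _) (ae_of_all _ Icc_subset_Ici_self))

/-- Window tails, norm form: `∫_{[t, t + L]} ‖f‖ → 0` as `t → +∞` for `f` integrable on `Ici a`.
[folklore] -/
theorem tendsto_setIntegral_Icc_add_norm_of_integrableOn {f : ℝ → E} {a : ℝ}
    (hf : IntegrableOn f (Ici a)) (L : ℝ) :
    Tendsto (fun t ↦ ∫ s in Icc t (t + L), ‖f s‖) atTop (𝓝 0) :=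
  tendsto_setIntegral_Icc_add_of_integrableOn hf.norm L

/-- Window tails, centred form ("flux tails on every window"): `∫_{[t - L, t + L]} f → 0` as
`t → +∞` for `f` integrable on `Ici a` and every half-width `L`. [folklore] -/
theorem tendsto_setIntegral_Icc_sub_add_of_integrableOn [NormedSpace ℝ E] {f : ℝ → E} {a : ℝ}
    (hf : IntegrableOn f (Ici a)) (L : ℝ) :
    Tendsto (fun t ↦ ∫ s in Icc (t - L) (t + L), f s) atTop (𝓝 0) := by
  have hshift : Tendsto (fun t : ℝ ↦ t - L) atTop atTop :=
    tendsto_atTop_atTop.2 fun b ↦ ⟨b + L, fun t ht ↦ by linarith⟩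
  refine ((tendsto_setIntegral_Icc_add_of_integrableOn hf (L + L)).comp hshift).congr fun t ↦ ?_
  show ∫ s in Icc (t - L) (t - L + (L + L)), f s = ∫ s in Icc (t - L) (t + L), f s
  rw [show t - L + (L + L) = t + L by ring]

/-- Window tails along a family of times `T n → +∞` (the discrete reading used by the dark-limit
dictionary: in the limit no budget is spent in any window `[T n - L, T n + L]`). [folklore] -/
theorem tendsto_setIntegral_Icc_sub_add_comp_of_tendsto [NormedSpace ℝ E] {f : ℝ → E} {a : ℝ}
    (hf : IntegrableOn f (Ici a)) (L : ℝ) {ι : Type*} {l : Filter ι} {T : ι → ℝ}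
    (hT : Tendsto T l atTop) :
    Tendsto (fun n ↦ ∫ s in Icc (T n - L) (T n + L), f s) l (𝓝 0) :=
  (tendsto_setIntegral_Icc_sub_add_of_integrableOn hf L).comp hT

/-- Window tails, measure form: a measure `μ` on the time axis giving finite mass to a half-line
`Ici a` (e.g. a finite news flux) charges the late windows `[t - L, t + L]` by amounts tending to
`0` as `t → +∞` (continuity from above along the half-lines `Ici t`, whose intersection is empty).
[folklore] -/
theorem tendsto_measure_Icc_sub_add_of_ne_top {μ : Measure ℝ} {a : ℝ} (h : μ (Ici a) ≠ ⊤)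
    (L : ℝ) : Tendsto (fun t ↦ μ (Icc (t - L) (t + L))) atTop (𝓝 0) := by
  have hempty : ⋂ t : ℝ, Ici t = ∅ :=
    iInter_eq_empty_iff.2 fun t ↦ ⟨t + 1, fun ht ↦ by have ht' := mem_Ici.1 ht; linarith⟩
  have hIci : Tendsto (fun t : ℝ ↦ μ (Ici t)) atTop (𝓝 0) := by
    have ht := tendsto_measure_iInter_atTop (μ := μ) (s := fun t : ℝ ↦ Ici t)
      (fun _ ↦ measurableSet_Ici.nullMeasurableSet) (fun _ _ huv ↦ Ici_subset_Ici.2 huv) ⟨a, h⟩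
    rwa [hempty, measure_empty] at ht
  have hshift : Tendsto (fun t : ℝ ↦ t - L) atTop atTop :=
    tendsto_atTop_atTop.2 fun b ↦ ⟨b + L, fun t ht ↦ by linarith⟩
  exact tendsto_of_tendsto_of_tendsto_of_le_of_le tendsto_const_nhds (hIci.comp hshift)
    (fun _ ↦ zero_le) fun _ ↦ measure_mono Icc_subset_Ici_self

/-! ### Barbalat's lemma -/

/-- **Barbalat's lemma** (normed-group form). A function `f : ℝ → E` which is uniformly continuous
and integrable on a half-line `Ici a` tends to `0` at `+∞`: otherwise `‖f t‖ ≥ ε` at arbitrarily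
late `t`, uniform continuity gives `‖f‖ ≥ ε / 2` on `[t, t + δ]`, and `∫_{[t, t + δ]} ‖f‖ ≥ ε δ / 2`
contradicts the window tails of `‖f‖` (Barbalat 1959; Khalil, *Nonlinear Systems*, Lemma 8.2).
[folklore] -/
theorem tendsto_zero_of_uniformContinuousOn_of_integrableOn {f : ℝ → E} {a : ℝ}
    (hu : UniformContinuousOn f (Ici a)) (hf : IntegrableOn f (Ici a)) :
    Tendsto f atTop (𝓝 0) := by
  rw [Metric.tendsto_nhds]
  intro ε hε
  obtain ⟨δ, hδ, hδf⟩ := Metric.uniformContinuousOn_iff_le.1 hu (ε / 2) (half_pos hε)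
  have hw := tendsto_setIntegral_Icc_add_norm_of_integrableOn hf δ
  filter_upwards [hw.eventually (gt_mem_nhds (by positivity : (0 : ℝ) < ε / 2 * δ)),
    eventually_ge_atTop a] with t ht hta
  rw [dist_zero_right]
  by_contra! hcon
  -- on the window `[t, t + δ]` the norm stays above `ε / 2`
  have hwin : ∀ s ∈ Icc t (t + δ), ε / 2 ≤ ‖f s‖ := by
    intro s hs
    have hts : dist t s ≤ δ := by
      rw [dist_comm, Real.dist_eq, abs_of_nonneg (by linarith [hs.1])]
      linarith [hs.2]
    have h1 : ‖f t - f s‖ ≤ ε / 2 := dist_eq_norm (f t) (f s) ▸ hδf t hta s (hta.trans hs.1) hts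
    linarith [norm_sub_norm_le (f t) (f s)]
  -- hence the window integral is at least `ε δ / 2`
  have hle : ε / 2 * δ ≤ ∫ s in Icc t (t + δ), ‖f s‖ := by
    have hfn : IntegrableOn (fun s ↦ ‖f s‖) (Icc t (t + δ)) :=
      IntegrableOn.mono_set hf.norm fun s hs ↦ hta.trans hs.1
    have h := setIntegral_ge_of_const_le_real (μ := volume) measurableSet_Icc
      measure_Icc_lt_top.ne hwin hfn
    rwa [Real.volume_real_Icc_of_le (by linarith), add_sub_cancel_left] at h
  linarith

/-- **Barbalat's lemma** (registered structure stub `barbalat_tendsto_zero` of line `Sketch`, crux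
stmt-FinalStateConjecture-14664; closed form). A real function uniformly continuous and integrable
on a half-line `[a, ∞)` tends to `0` at `+∞`. No sign condition is needed: the textbook statement
for a nonnegative integrable dissipation rate (Barbalat 1959; Khalil, *Nonlinear Systems*, 3rd ed.,
Lemma 8.2) is the special case `0 ≤ f`. [folklore] -/
theorem barbalat_tendsto_zero :
    ∀ {f : ℝ → ℝ} {a : ℝ}, UniformContinuousOn f (Ici a) → IntegrableOn f (Ici a) →
      Tendsto f atTop (𝓝 0) := by
  intro f a hu hf
  exact tendsto_zero_of_uniformContinuousOn_of_integrableOn hu hf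

/-- Barbalat's lemma, Lipschitz (tame) form: a function Lipschitz and integrable on a half-line
`Ici a` tends to `0` at `+∞`. [folklore] -/
theorem tendsto_zero_of_lipschitzOnWith_of_integrableOn {f : ℝ → E} {a : ℝ} {K : ℝ≥0}
    (hK : LipschitzOnWith K f (Ici a)) (hf : IntegrableOn f (Ici a)) :
    Tendsto f atTop (𝓝 0) :=
  tendsto_zero_of_uniformContinuousOn_of_integrableOn hK.uniformContinuousOn hf

end Summit.FinalStateConjecture.FinalStateConjecture.Theorems.ClusterCompleteness

end
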